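import Mathlib
import Literature.NumberTheory.LFunctions.Zhang2022.RepairBedScale
import Literature.NumberTheory.LFunctions.Zhang2022.Section2Assembly
import HarnessLib

/-!
# Zhang (2022), rescue bed (D-0124 (3)) Tier S: the §2 endgame structure ((2.16)–(2.20), (2.18), (8.2),
# Cauchy–Schwarz) holds for the BED sums at ANY scale — kernel sanity constraints on Tier-S rows

Topic `Literature/NumberTheory/LFunctions/Zhang2022` (Landau–Siegel audit tree; verdict-neutral).
Y. Zhang, *Discrete mean estimates and the Landau–Siegel zero*, arXiv:2211.02515v1 (2022)
[Zhang2022LandauSiegel] — **an unrefereed manuscript under adjudication; nothing in this file asserts or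
denies any of its claims, and nothing here is a claim about Landau–Siegel zeros.**

Purpose. `RepairBedScale` defines the §2 objects over an explicit `Scale` for an arbitrary character
`ψ (mod p)` and the per-zero summands / sums over an explicit finite zero set `Z` (`xiStar1Sum`, `xi1Sum`,
`xiJSum`, `xi11Sum`, `xi12Sum`, `xi13Sum`, `xi3sqSum`). A Tier-S bed row reports these numbers at a registered
scale. This file records that the manuscript's §2 endgame ALGEBRA — the tree's abstract `EndgameData`
(`Section2Assembly`: any finite family with weights `𝔠* ≥ 0`, `ω > 0` and `|Z| = 1`) — applies verbatim to the bed
sums, at every scale and for every character and zero set satisfying the three pointwise facts the bed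
verifies anyway (`𝔠*(ρ,ψ)` real `≥ 0`, `ω(ρ)` real `> 0`, `|Z(ρ,ψχ)| = 1`):

* `xiStar2Term/xiStar3Term` (+ sums, `rfl`-regression to `Skeleton.xiStar2/xiStar3`) — the (2.19)/(2.20) summands
  that were not yet in `RepairBedScale`;
* `bedDatum S χ ψ c' Z …  : EndgameData Z` and the identifications `bedDatum_xi1 = xi1Sum …` etc.;
* **kernel constraints every Tier-S row block must satisfy** (a violation = an engine defect, by theorem):
  (2.18) `‖xiStar1Sum‖ ≤ xiStar2Sum + xiStar3Sum`; (8.2) `xi1Sum = xi11Sum + xi12Sum + 2 Re xi13Sum`;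
  Cauchy–Schwarz `xiStar2Sum² ≤ xi1Sum·xiJSum`; non-negativity of `xi1Sum`, `xiJSum`;
* **the endgame obstruction at bed scale**: with `aP > 0` any normaliser, ratios `d ≤ ‖Ξ₁*‖/aP`, `Ξ₁ ≤ q·aP`,
  `Ξ_J ≤ c_J·aP`, `Ξ₃* ≤ ε·aP` force `d ≤ √(q·c_J) + ε` (`bed_ratio_le`) — so NO bed data can show the
  closing pattern `√(q c_J) + ε < d` (`bed_not_closing`): the Cauchy–Schwarz obstruction of the endgame
  (`Repair.not_repairable_true_need` at main order) is visible on every finite data set as an inequality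
  between the measured sums themselves.

* (rev 2) ABS-WEIGHT TWINS `xi1AbsSum`, `xiJAbsSum`, `xiStar2AbsSum`, `xiStar3AbsSum` (weight `|Re 𝔠*|`) with the
  UNCONDITIONAL controls `norm_xiStar1Sum_le_abs` ((2.18), no sign hypothesis on `𝔠*`), `xiStar2AbsSum_sq_le` (CS),
  `xi1Sum_le_abs`, `bed_ratio_le_abs` — at genuine zeros `Re 𝔠* ≥ 0` fails in most blocks (the bed's datum),
  so these are the per-block engine-defect detectors, and the signed versions are the (A)-fenced checks.
* (rev 3) FAMILY TOTALS over a finite family of characters (`BedChr`, `xiStar1Fam`, `xi1AbsFam`, `xiJAbsFam`,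
  `xiStar2AbsFam`, `xiStar3AbsFam`): `norm_xiStar1Fam_le_abs`, `xiStar2AbsFam_sq_le` (CS survives summation over
  blocks), `bed_ratio_le_abs_fam` — the same unconditional controls for a spec's block totals.

Pure algebra over finite sums (instances of `EndgameData` theorems); no analytic content; no `instance`, no notation.

## References

* Y. Zhang, arXiv:2211.02515v1 (2022), §2 (2.16)–(2.20), (2.32)–(2.33), §8 (8.1)–(8.5).
  [cite: Zhang2022LandauSiegel, §§2, 8]
-/

noncomputable section

open Complex Real ComplexConjugate

namespace Literature.NumberTheory.LFunctions.Zhang2022.Repair.Bed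

section PerCharacter

variable (S : Scale) {D : ℕ} [NeZero D] (χ : DirichletCharacter ℂ D) {p : ℕ} [NeZero p]
  (ψ : DirichletCharacter ℂ p)

/-! ## The (2.19)/(2.20) summands at bed scale -/

/-- Summand of `Ξ₂*` (2.19): `Re 𝔠*·(|H₁ + ZH̄₂|·|J₁|)·Re ω`. [cite: Zhang2022LandauSiegel, §2 (2.19)] -/
def xiStar2Term (c' : ℝ) (ρ : ℂ) : ℝ :=
  (cstar S ψ c' ρ).re * (‖H1 S χ ψ ρ + Zpc χ ψ ρ * conj (H2 S χ ψ ρ)‖ * ‖J1 S χ ψ ρ‖) * (omegaW S ρ).re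

/-- Summand of `Ξ₃*` (2.20): `Re 𝔠*·(|J₁ − ZJ̄₂|·|H₂|)·Re ω`. [cite: Zhang2022LandauSiegel, §2 (2.20)] -/
def xiStar3Term (c' : ℝ) (ρ : ℂ) : ℝ :=
  (cstar S ψ c' ρ).re * (‖J1 S χ ψ ρ - Zpc χ ψ ρ * conj (J2 S χ ψ ρ)‖ * ‖H2 S χ ψ ρ‖) * (omegaW S ρ).re

/-- `Ξ₂*` restricted to one character and an explicit finite zero set. [cite: Zhang2022LandauSiegel, §2 (2.19)] -/
def xiStar2Sum (c' : ℝ) (Z : Finset ℂ) : ℝ := ∑ ρ ∈ Z, xiStar2Term S χ ψ c' ρ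

/-- `Ξ₃*` restricted to one character and an explicit finite zero set. [cite: Zhang2022LandauSiegel, §2 (2.20)] -/
def xiStar3Sum (c' : ℝ) (Z : Finset ℂ) : ℝ := ∑ ρ ∈ Z, xiStar3Term S χ ψ c' ρ

/-! ## The bed datum: an `EndgameData` over the explicit zero set -/

/-- **The bed sums as an `EndgameData`** over the finite zero set `Z` (index type `↥Z`), given the three
pointwise facts at every `ρ ∈ Z`: `Re 𝔠*(ρ,ψ) ≥ 0`, `Re ω(ρ) > 0`, `|Z(ρ,ψχ)| = 1`.
[cite: Zhang2022LandauSiegel, §2 (2.16)–(2.17), Lemma 2.3] -/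
def bedDatum (c' : ℝ) (Z : Finset ℂ) (hc : ∀ ρ ∈ Z, 0 ≤ (cstar S ψ c' ρ).re)
    (hω : ∀ ρ ∈ Z, 0 < (omegaW S ρ).re) (hZ : ∀ ρ ∈ Z, ‖Zpc χ ψ ρ‖ = 1) : EndgameData Z where
  cstar i := (cstar S ψ c' i.1).re
  omega i := (omegaW S i.1).re
  H₁ i := H1 S χ ψ i.1
  H₂ i := H2 S χ ψ i.1
  J₁ i := J1 S χ ψ i.1
  J₂ i := J2 S χ ψ i.1
  Z i := Zpc χ ψ i.1
  cstar_nonneg i := hc i.1 i.2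
  omega_pos i := hω i.1 i.2
  norm_Z i := hZ i.1 i.2

variable {S χ ψ} {c' : ℝ} {Z : Finset ℂ} {hc : ∀ ρ ∈ Z, 0 ≤ (cstar S ψ c' ρ).re}
  {hω : ∀ ρ ∈ Z, 0 < (omegaW S ρ).re} {hZ : ∀ ρ ∈ Z, ‖Zpc χ ψ ρ‖ = 1}

/-- A complex number with zero imaginary part is the cast of its real part. [folklore] -/
private theorem ofReal_re_eq' {z : ℂ} (h : z.im = 0) : ((z.re : ℝ) : ℂ) = z :=
  Complex.ext (by simp) (by simp [h])

/-- `Ξ₁` of the bed datum is `xi1Sum`. [cite: Zhang2022LandauSiegel, §2 (2.32)] -/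
theorem bedDatum_xi1 : (bedDatum S χ ψ c' Z hc hω hZ).xi1 = xi1Sum S χ ψ c' Z := by
  rw [xi1Sum, ← Finset.sum_coe_sort]; rfl

/-- `Ξ_J` of the bed datum is `xiJSum`. [cite: Zhang2022LandauSiegel, §2 (2.33)] -/
theorem bedDatum_xiJ : (bedDatum S χ ψ c' Z hc hω hZ).xiJ = xiJSum S χ ψ c' Z := by
  rw [xiJSum, ← Finset.sum_coe_sort]; rfl

/-- `Ξ₁₁` of the bed datum is `xi11Sum`. [cite: Zhang2022LandauSiegel, §8 (8.3)] -/
theorem bedDatum_xi11 : (bedDatum S χ ψ c' Z hc hω hZ).xi11 = xi11Sum S χ ψ c' Z := by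
  rw [xi11Sum, ← Finset.sum_coe_sort]; rfl

/-- `Ξ₁₂` of the bed datum is `xi12Sum`. [cite: Zhang2022LandauSiegel, §8 (8.4)] -/
theorem bedDatum_xi12 : (bedDatum S χ ψ c' Z hc hω hZ).xi12 = xi12Sum S χ ψ c' Z := by
  rw [xi12Sum, ← Finset.sum_coe_sort]; rfl

/-- `Ξ₂*` of the bed datum is `xiStar2Sum`. [cite: Zhang2022LandauSiegel, §2 (2.19)] -/
theorem bedDatum_xiStar2 : (bedDatum S χ ψ c' Z hc hω hZ).xiStar2 = xiStar2Sum S χ ψ c' Z := by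
  rw [xiStar2Sum, ← Finset.sum_coe_sort]; rfl

/-- `Ξ₃*` of the bed datum is `xiStar3Sum`. [cite: Zhang2022LandauSiegel, §2 (2.20)] -/
theorem bedDatum_xiStar3 : (bedDatum S χ ψ c' Z hc hω hZ).xiStar3 = xiStar3Sum S χ ψ c' Z := by
  rw [xiStar3Sum, ← Finset.sum_coe_sort]; rfl

/-- `Ξ₁*` of the bed datum is `xiStar1Sum`, given `𝔠*`, `ω` REAL at every zero.
[cite: Zhang2022LandauSiegel, §2 (2.17)] -/
theorem bedDatum_xiStar1 (hci : ∀ ρ ∈ Z, (cstar S ψ c' ρ).im = 0) (hωi : ∀ ρ ∈ Z, (omegaW S ρ).im = 0) :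
    (bedDatum S χ ψ c' Z hc hω hZ).xiStar1 = xiStar1Sum S χ ψ c' Z := by
  rw [xiStar1Sum, ← Finset.sum_coe_sort]
  refine Finset.sum_congr rfl fun i _ => ?_
  simp only [bedDatum, xiStar1Term]
  rw [ofReal_re_eq' (hci i.1 i.2), ofReal_re_eq' (hωi i.1 i.2)]

/-- `Ξ₁₃` of the bed datum is `xi13Sum`, given `𝔠*`, `ω` real at every zero.
[cite: Zhang2022LandauSiegel, §8 (8.5)] -/
theorem bedDatum_xi13 (hci : ∀ ρ ∈ Z, (cstar S ψ c' ρ).im = 0) (hωi : ∀ ρ ∈ Z, (omegaW S ρ).im = 0) :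
    (bedDatum S χ ψ c' Z hc hω hZ).xi13 = xi13Sum S χ ψ c' Z := by
  rw [xi13Sum, ← Finset.sum_coe_sort]
  refine Finset.sum_congr rfl fun i _ => ?_
  simp only [bedDatum, xi13Term]
  rw [ofReal_re_eq' (hci i.1 i.2), ofReal_re_eq' (hωi i.1 i.2)]
  ring

/-! ## Kernel constraints on Tier-S row blocks -/

/-- **(2.18) at bed scale**: `‖Ξ₁*‖ ≤ Ξ₂* + Ξ₃*` for the bed sums over any finite zero set on which `𝔠*`, `ω` are
real, `𝔠* ≥ 0`, `ω > 0`, `|Z| = 1`. [cite: Zhang2022LandauSiegel, §2 (2.18)] -/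
theorem norm_xiStar1Sum_le (hc : ∀ ρ ∈ Z, 0 ≤ (cstar S ψ c' ρ).re) (hci : ∀ ρ ∈ Z, (cstar S ψ c' ρ).im = 0)
    (hω : ∀ ρ ∈ Z, 0 < (omegaW S ρ).re) (hωi : ∀ ρ ∈ Z, (omegaW S ρ).im = 0)
    (hZ : ∀ ρ ∈ Z, ‖Zpc χ ψ ρ‖ = 1) :
    ‖xiStar1Sum S χ ψ c' Z‖ ≤ xiStar2Sum S χ ψ c' Z + xiStar3Sum S χ ψ c' Z := by
  have h := (bedDatum S χ ψ c' Z hc hω hZ).norm_xiStar1_le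
  rwa [bedDatum_xiStar1 hci hωi, bedDatum_xiStar2, bedDatum_xiStar3] at h

/-- **(8.2) at bed scale, summed**: `Ξ₁ = Ξ₁₁ + Ξ₁₂ + 2Re Ξ₁₃` for the bed sums (same hypotheses).
[cite: Zhang2022LandauSiegel, §8 (8.2)] -/
theorem xi1Sum_eq_parts (hc : ∀ ρ ∈ Z, 0 ≤ (cstar S ψ c' ρ).re) (hci : ∀ ρ ∈ Z, (cstar S ψ c' ρ).im = 0)
    (hω : ∀ ρ ∈ Z, 0 < (omegaW S ρ).re) (hωi : ∀ ρ ∈ Z, (omegaW S ρ).im = 0)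
    (hZ : ∀ ρ ∈ Z, ‖Zpc χ ψ ρ‖ = 1) :
    xi1Sum S χ ψ c' Z = xi11Sum S χ ψ c' Z + xi12Sum S χ ψ c' Z + 2 * (xi13Sum S χ ψ c' Z).re := by
  have h := (bedDatum S χ ψ c' Z hc hω hZ).xi1_eq
  rwa [bedDatum_xi1, bedDatum_xi11, bedDatum_xi12, bedDatum_xi13 hci hωi] at h

/-- **Cauchy–Schwarz at bed scale**: `(Ξ₂*)² ≤ Ξ₁·Ξ_J` for the bed sums (weights `𝔠* ≥ 0`, `ω > 0`, `|Z| = 1`).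
[cite: Zhang2022LandauSiegel, §2, remark after Prop. 2.6] -/
theorem xiStar2Sum_sq_le (hc : ∀ ρ ∈ Z, 0 ≤ (cstar S ψ c' ρ).re) (hω : ∀ ρ ∈ Z, 0 < (omegaW S ρ).re)
    (hZ : ∀ ρ ∈ Z, ‖Zpc χ ψ ρ‖ = 1) :
    xiStar2Sum S χ ψ c' Z ^ 2 ≤ xi1Sum S χ ψ c' Z * xiJSum S χ ψ c' Z := by
  have h := (bedDatum S χ ψ c' Z hc hω hZ).xiStar2_sq_le
  rwa [bedDatum_xiStar2, bedDatum_xi1, bedDatum_xiJ] at h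

/-- `Ξ₁ ≥ 0` and `Ξ_J ≥ 0` for the bed sums ((2.16) with weights `𝔠* ≥ 0`, `ω > 0`).
[cite: Zhang2022LandauSiegel, §2 (2.16)] -/
theorem xi1Sum_nonneg_and (hc : ∀ ρ ∈ Z, 0 ≤ (cstar S ψ c' ρ).re) (hω : ∀ ρ ∈ Z, 0 < (omegaW S ρ).re)
    (hZ : ∀ ρ ∈ Z, ‖Zpc χ ψ ρ‖ = 1) : 0 ≤ xi1Sum S χ ψ c' Z ∧ 0 ≤ xiJSum S χ ψ c' Z := by
  refine ⟨?_, ?_⟩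
  · have h := (bedDatum S χ ψ c' Z hc hω hZ).xi1_nonneg; rwa [bedDatum_xi1] at h
  · have h := (bedDatum S χ ψ c' Z hc hω hZ).xiJ_nonneg; rwa [bedDatum_xiJ] at h

/-- **The endgame obstruction at bed scale**: for ANY normaliser `aP > 0`, if the bed's numbers satisfy
`d·aP ≤ ‖Ξ₁*‖`, `Ξ₁ ≤ q·aP`, `Ξ_J ≤ c_J·aP`, `Ξ₃* ≤ ε·aP`, then `d ≤ √(q·c_J) + ε`
(`EndgameData.le_sqrt_add_of_skeleton`). [cite: Zhang2022LandauSiegel, §2 (2.18), p. 6] -/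
theorem bed_ratio_le {aP d q cJ ε : ℝ} (haP : 0 < aP)
    (hc : ∀ ρ ∈ Z, 0 ≤ (cstar S ψ c' ρ).re) (hci : ∀ ρ ∈ Z, (cstar S ψ c' ρ).im = 0)
    (hω : ∀ ρ ∈ Z, 0 < (omegaW S ρ).re) (hωi : ∀ ρ ∈ Z, (omegaW S ρ).im = 0)
    (hZ : ∀ ρ ∈ Z, ‖Zpc χ ψ ρ‖ = 1)
    (h24 : d * aP ≤ ‖xiStar1Sum S χ ψ c' Z‖) (h232 : xi1Sum S χ ψ c' Z ≤ q * aP)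
    (h233 : xiJSum S χ ψ c' Z ≤ cJ * aP) (h26 : xiStar3Sum S χ ψ c' Z ≤ ε * aP) :
    d ≤ Real.sqrt (q * cJ) + ε := by
  refine (bedDatum S χ ψ c' Z hc hω hZ).le_sqrt_add_of_skeleton haP ?_ ?_ ?_ ?_
  · rwa [bedDatum_xiStar1 hci hωi]
  · rwa [bedDatum_xi1]
  · rwa [bedDatum_xiJ]
  · rwa [bedDatum_xiStar3]

/-- **No bed data shows the closing pattern**: the four measured ratios can never satisfy
`√(q·c_J) + ε < d` (the Cauchy–Schwarz obstruction of the endgame, as an inequality between the bed's own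
sums). [cite: Zhang2022LandauSiegel, §2 (2.18), p. 6] -/
theorem bed_not_closing {aP d q cJ ε : ℝ} (haP : 0 < aP) (hclose : Real.sqrt (q * cJ) + ε < d)
    (hc : ∀ ρ ∈ Z, 0 ≤ (cstar S ψ c' ρ).re) (hci : ∀ ρ ∈ Z, (cstar S ψ c' ρ).im = 0)
    (hω : ∀ ρ ∈ Z, 0 < (omegaW S ρ).re) (hωi : ∀ ρ ∈ Z, (omegaW S ρ).im = 0)
    (hZ : ∀ ρ ∈ Z, ‖Zpc χ ψ ρ‖ = 1)
    (h24 : d * aP ≤ ‖xiStar1Sum S χ ψ c' Z‖) (h232 : xi1Sum S χ ψ c' Z ≤ q * aP)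
    (h233 : xiJSum S χ ψ c' Z ≤ cJ * aP) (h26 : xiStar3Sum S χ ψ c' Z ≤ ε * aP) : False :=
  (lt_irrefl d) ((bed_ratio_le haP hc hci hω hωi hZ h24 h232 h233 h26).trans_lt hclose)

end PerCharacter

/-! ## Regression: the (2.19)/(2.20) summands at Zhang's scale -/

section Regression

variable (c' : ℝ) (D : ℕ) [NeZero D] (χ : DirichletCharacter ℂ D)

/-- `Ξ₂*` is the sum of the bed summands over the skeleton's index set. [cite: Zhang2022LandauSiegel, §2 (2.19)] -/
theorem xiStar2_eq_sum_term :
    Skeleton.xiStar2 c' χ = ∑ i ∈ Skeleton.idx χ, xiStar2Term (Scale.zhang D) χ i.1.ψ c' i.2 := rfl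

/-- `Ξ₃*` is the sum of the bed summands over the skeleton's index set. [cite: Zhang2022LandauSiegel, §2 (2.20)] -/
theorem xiStar3_eq_sum_term :
    Skeleton.xiStar3 c' χ = ∑ i ∈ Skeleton.idx χ, xiStar3Term (Scale.zhang D) χ i.1.ψ c' i.2 := rfl

end Regression

/-! ## Abs-weight twins: the UNCONDITIONAL controls (rev 2)

At genuine zeros the Lemma 2.3 sign `Re 𝔠*(ρ,ψ) ≥ 0` fails in most blocks (bed-1, INBOX 2026-08-27T07:59:07Z:
it is an (A)-consequence via Prop 2.2 (iii), exactly what genuine data lack), so (2.18)/CS above are CONDITIONAL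
row checks. Replacing the weight `Re 𝔠*` by `|Re 𝔠*|` gives sums (`…AbsSum`) for which the triangle inequality
and Cauchy–Schwarz hold with NO sign hypothesis on `𝔠*` — only `𝔠*`, `ω` real, `Re ω > 0` and `|Z| = 1`
(automatic for zeros on the critical line and `ψχ` primitive): these are engine-defect detectors in every block,
and `xi1Sum ≤ xi1AbsSum` etc. quantify what the sign failures can contribute. -/

section AbsWeights

variable (S : Scale) {D : ℕ} [NeZero D] (χ : DirichletCharacter ℂ D) {p : ℕ} [NeZero p]
  (ψ : DirichletCharacter ℂ p)

/-- `Ξ₁` with the weight `|Re 𝔠*|`: `|Re 𝔠*|·|H₁ + ZH̄₂|²·Re ω` summed over `Z`. [cite: Zhang2022LandauSiegel, §2 (2.32)] -/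
def xi1AbsSum (c' : ℝ) (Z : Finset ℂ) : ℝ :=
  ∑ ρ ∈ Z, |(cstar S ψ c' ρ).re| * ‖H1 S χ ψ ρ + Zpc χ ψ ρ * conj (H2 S χ ψ ρ)‖ ^ 2 * (omegaW S ρ).re

/-- `Ξ_J` with the weight `|Re 𝔠*|`. [cite: Zhang2022LandauSiegel, §2 (2.33)] -/
def xiJAbsSum (c' : ℝ) (Z : Finset ℂ) : ℝ :=
  ∑ ρ ∈ Z, |(cstar S ψ c' ρ).re| * ‖J1 S χ ψ ρ‖ ^ 2 * (omegaW S ρ).re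

/-- `Ξ₂*` with the weight `|Re 𝔠*|`. [cite: Zhang2022LandauSiegel, §2 (2.19)] -/
def xiStar2AbsSum (c' : ℝ) (Z : Finset ℂ) : ℝ :=
  ∑ ρ ∈ Z, |(cstar S ψ c' ρ).re| * (‖H1 S χ ψ ρ + Zpc χ ψ ρ * conj (H2 S χ ψ ρ)‖ * ‖J1 S χ ψ ρ‖) * (omegaW S ρ).re

/-- `Ξ₃*` with the weight `|Re 𝔠*|`. [cite: Zhang2022LandauSiegel, §2 (2.20)] -/
def xiStar3AbsSum (c' : ℝ) (Z : Finset ℂ) : ℝ :=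
  ∑ ρ ∈ Z, |(cstar S ψ c' ρ).re| * (‖J1 S χ ψ ρ - Zpc χ ψ ρ * conj (J2 S χ ψ ρ)‖ * ‖H2 S χ ψ ρ‖) * (omegaW S ρ).re

/-- **The abs-weight datum**: an `EndgameData` over `Z` with weight `|Re 𝔠*(ρ,ψ)|` — NO sign hypothesis on `𝔠*`;
only `Re ω > 0` and `|Z(ρ,ψχ)| = 1`. [cite: Zhang2022LandauSiegel, §2 (2.16)–(2.17)] -/
def absDatum (c' : ℝ) (Z : Finset ℂ) (hω : ∀ ρ ∈ Z, 0 < (omegaW S ρ).re) (hZ : ∀ ρ ∈ Z, ‖Zpc χ ψ ρ‖ = 1) :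
    EndgameData Z where
  cstar i := |(cstar S ψ c' i.1).re|
  omega i := (omegaW S i.1).re
  H₁ i := H1 S χ ψ i.1
  H₂ i := H2 S χ ψ i.1
  J₁ i := J1 S χ ψ i.1
  J₂ i := J2 S χ ψ i.1
  Z i := Zpc χ ψ i.1
  cstar_nonneg _ := abs_nonneg _
  omega_pos i := hω i.1 i.2
  norm_Z i := hZ i.1 i.2

variable {S χ ψ} {c' : ℝ} {Z : Finset ℂ} {hω : ∀ ρ ∈ Z, 0 < (omegaW S ρ).re} {hZ : ∀ ρ ∈ Z, ‖Zpc χ ψ ρ‖ = 1}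

/-- `Ξ₁` of the abs datum is `xi1AbsSum`. [cite: Zhang2022LandauSiegel, §2 (2.32)] -/
theorem absDatum_xi1 : (absDatum S χ ψ c' Z hω hZ).xi1 = xi1AbsSum S χ ψ c' Z := by
  rw [xi1AbsSum, ← Finset.sum_coe_sort]; rfl

/-- `Ξ_J` of the abs datum is `xiJAbsSum`. [cite: Zhang2022LandauSiegel, §2 (2.33)] -/
theorem absDatum_xiJ : (absDatum S χ ψ c' Z hω hZ).xiJ = xiJAbsSum S χ ψ c' Z := by
  rw [xiJAbsSum, ← Finset.sum_coe_sort]; rfl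

/-- `Ξ₂*` of the abs datum is `xiStar2AbsSum`. [cite: Zhang2022LandauSiegel, §2 (2.19)] -/
theorem absDatum_xiStar2 : (absDatum S χ ψ c' Z hω hZ).xiStar2 = xiStar2AbsSum S χ ψ c' Z := by
  rw [xiStar2AbsSum, ← Finset.sum_coe_sort]; rfl

/-- `Ξ₃*` of the abs datum is `xiStar3AbsSum`. [cite: Zhang2022LandauSiegel, §2 (2.20)] -/
theorem absDatum_xiStar3 : (absDatum S χ ψ c' Z hω hZ).xiStar3 = xiStar3AbsSum S χ ψ c' Z := by
  rw [xiStar3AbsSum, ← Finset.sum_coe_sort]; rfl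

/-- **(2.18) with abs weights, UNCONDITIONAL in the sign of `𝔠*`**: for `𝔠*`, `ω` real with `Re ω ≥ 0` and
`|Z| = 1` at every `ρ ∈ Z`, `‖xiStar1Sum‖ ≤ xiStar2AbsSum + xiStar3AbsSum` (triangle inequality + the termwise
bound before (2.18)). [cite: Zhang2022LandauSiegel, §2 (2.18)] -/
theorem norm_xiStar1Sum_le_abs (hci : ∀ ρ ∈ Z, (cstar S ψ c' ρ).im = 0) (hω0 : ∀ ρ ∈ Z, 0 ≤ (omegaW S ρ).re)
    (hωi : ∀ ρ ∈ Z, (omegaW S ρ).im = 0) (hZ : ∀ ρ ∈ Z, ‖Zpc χ ψ ρ‖ = 1) :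
    ‖xiStar1Sum S χ ψ c' Z‖ ≤ xiStar2AbsSum S χ ψ c' Z + xiStar3AbsSum S χ ψ c' Z := by
  unfold xiStar1Sum xiStar2AbsSum xiStar3AbsSum
  rw [← Finset.sum_add_distrib]
  refine (norm_sum_le _ _).trans (Finset.sum_le_sum fun ρ hρ => ?_)
  unfold xiStar1Term
  have hc : ‖cstar S ψ c' ρ‖ = |(cstar S ψ c' ρ).re| := by
    rw [← Complex.abs_re_eq_norm.mpr (hci ρ hρ)]
  have hw : ‖omegaW S ρ‖ = (omegaW S ρ).re := by
    rw [← Complex.abs_re_eq_norm.mpr (hωi ρ hρ), abs_of_nonneg (hω0 ρ hρ)]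
  have h := norm_cross_le (hZ ρ hρ) (H1 S χ ψ ρ) (H2 S χ ψ ρ) (J1 S χ ψ ρ) (J2 S χ ψ ρ)
  rw [norm_mul, norm_mul, hc, hw]
  calc |(cstar S ψ c' ρ).re| * ‖H1 S χ ψ ρ * conj (J1 S χ ψ ρ) + conj (H2 S χ ψ ρ) * J2 S χ ψ ρ‖ * (omegaW S ρ).re
      ≤ |(cstar S ψ c' ρ).re| * (‖H1 S χ ψ ρ + Zpc χ ψ ρ * conj (H2 S χ ψ ρ)‖ * ‖J1 S χ ψ ρ‖
          + ‖J1 S χ ψ ρ - Zpc χ ψ ρ * conj (J2 S χ ψ ρ)‖ * ‖H2 S χ ψ ρ‖) * (omegaW S ρ).re :=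
        mul_le_mul_of_nonneg_right (mul_le_mul_of_nonneg_left h (abs_nonneg _)) (hω0 ρ hρ)
    _ = _ := by ring

/-- **Cauchy–Schwarz with abs weights, unconditional in the sign of `𝔠*`**: `xiStar2AbsSum² ≤ xi1AbsSum·xiJAbsSum`
(`Re ω > 0`, `|Z| = 1`). [cite: Zhang2022LandauSiegel, §2, remark after Prop. 2.6] -/
theorem xiStar2AbsSum_sq_le (hω : ∀ ρ ∈ Z, 0 < (omegaW S ρ).re) (hZ : ∀ ρ ∈ Z, ‖Zpc χ ψ ρ‖ = 1) :
    xiStar2AbsSum S χ ψ c' Z ^ 2 ≤ xi1AbsSum S χ ψ c' Z * xiJAbsSum S χ ψ c' Z := by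
  have h := (absDatum S χ ψ c' Z hω hZ).xiStar2_sq_le
  rwa [absDatum_xiStar2, absDatum_xi1, absDatum_xiJ] at h

/-- The signed sums are dominated by the abs-weight sums: `xi1Sum ≤ xi1AbsSum`, `xiJSum ≤ xiJAbsSum` (`Re ω ≥ 0`).
[cite: Zhang2022LandauSiegel, §2 (2.16)] -/
theorem xi1Sum_le_abs (hω0 : ∀ ρ ∈ Z, 0 ≤ (omegaW S ρ).re) :
    xi1Sum S χ ψ c' Z ≤ xi1AbsSum S χ ψ c' Z ∧ xiJSum S χ ψ c' Z ≤ xiJAbsSum S χ ψ c' Z := by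
  refine ⟨Finset.sum_le_sum fun ρ hρ => ?_, Finset.sum_le_sum fun ρ hρ => ?_⟩
  · unfold xi1Term
    exact mul_le_mul_of_nonneg_right (mul_le_mul_of_nonneg_right (le_abs_self _) (sq_nonneg _)) (hω0 ρ hρ)
  · unfold xiJTerm
    exact mul_le_mul_of_nonneg_right (mul_le_mul_of_nonneg_right (le_abs_self _) (sq_nonneg _)) (hω0 ρ hρ)

/-- **The unconditional endgame bound on the bed's numbers**: with abs-weight ratios `Ξ₁ᵃᵇˢ ≤ q·aP`, `Ξ_Jᵃᵇˢ ≤ c_J·aP`,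
`Ξ₃*ᵃᵇˢ ≤ ε·aP` and `d·aP ≤ ‖Ξ₁*‖`, one has `d ≤ √(q·c_J) + ε` — NO sign hypothesis on `𝔠*`
(`𝔠*`, `ω` real, `Re ω > 0`, `|Z| = 1`). [cite: Zhang2022LandauSiegel, §2 (2.18), p. 6] -/
theorem bed_ratio_le_abs {aP d q cJ ε : ℝ} (haP : 0 < aP) (hci : ∀ ρ ∈ Z, (cstar S ψ c' ρ).im = 0)
    (hω : ∀ ρ ∈ Z, 0 < (omegaW S ρ).re) (hωi : ∀ ρ ∈ Z, (omegaW S ρ).im = 0)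
    (hZ : ∀ ρ ∈ Z, ‖Zpc χ ψ ρ‖ = 1)
    (h24 : d * aP ≤ ‖xiStar1Sum S χ ψ c' Z‖) (h232 : xi1AbsSum S χ ψ c' Z ≤ q * aP)
    (h233 : xiJAbsSum S χ ψ c' Z ≤ cJ * aP) (h26 : xiStar3AbsSum S χ ψ c' Z ≤ ε * aP) :
    d ≤ Real.sqrt (q * cJ) + ε := by
  set E := absDatum S χ ψ c' Z hω hZ with hE
  have h218 := norm_xiStar1Sum_le_abs hci (fun ρ hρ => (hω ρ hρ).le) hωi hZ
  have hx1 : 0 ≤ xi1AbsSum S χ ψ c' Z := by rw [← absDatum_xi1 (hω := hω) (hZ := hZ)]; exact E.xi1_nonneg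
  have hxJ : 0 ≤ xiJAbsSum S χ ψ c' Z := by rw [← absDatum_xiJ (hω := hω) (hZ := hZ)]; exact E.xiJ_nonneg
  have hq : 0 ≤ q := by nlinarith
  have hcJ : 0 ≤ cJ := by nlinarith
  have h2 : xiStar2AbsSum S χ ψ c' Z ≤ Real.sqrt (q * cJ) * aP :=
    calc xiStar2AbsSum S χ ψ c' Z = E.xiStar2 := (absDatum_xiStar2 (hω := hω) (hZ := hZ)).symm
      _ ≤ Real.sqrt (E.xi1 * E.xiJ) := E.xiStar2_le_sqrt
      _ ≤ Real.sqrt (q * aP * (cJ * aP)) := by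
          rw [absDatum_xi1, absDatum_xiJ]
          exact Real.sqrt_le_sqrt (mul_le_mul h232 h233 hxJ (by positivity))
      _ = Real.sqrt (q * cJ) * aP := by
          rw [show q * aP * (cJ * aP) = q * cJ * (aP * aP) by ring,
            Real.sqrt_mul (mul_nonneg hq hcJ), Real.sqrt_mul_self haP.le]
  have h3 : d * aP ≤ (Real.sqrt (q * cJ) + ε) * aP := by nlinarith
  exact le_of_mul_le_mul_right h3 haP

end AbsWeights

/-! ## Family totals (rev 3): the same unconditional controls for the bed's block TOTALS over a finite family of
characters

A Tier-S spec sums over an explicit finite family of characters `ψ (mod p)` (one block per `ψ`); the abs-weight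
controls aggregate over blocks: the triangle inequality sums, and Cauchy–Schwarz survives summation over disjoint
blocks (`Finset.sum_sq_le_sum_mul_sum_of_sq_le_mul`). A family member is a record `BedChr` (prime modulus + character;
no instance is declared — the `NeZero` witness is supplied in-term). -/

section Family

/-- A member of a bed family: a prime modulus `p` and a character `ψ (mod p)` (any character; the bed lists the
primitive ones it uses). [cite: Zhang2022LandauSiegel, §2 p. 4] -/
structure BedChr where
  /-- the modulus -/
  p : ℕ
  /-- `p` is prime -/
  prime : p.Prime
  /-- the character `ψ (mod p)` -/
  ψ : DirichletCharacter ℂ p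

variable (S : Scale) {D : ℕ} [NeZero D] (χ : DirichletCharacter ℂ D) (c' : ℝ) (F : Finset BedChr)
  (Zs : BedChr → Finset ℂ)

/-- Family total of `Ξ₁*` over the blocks `x ∈ F` with zero sets `Zs x`. [cite: Zhang2022LandauSiegel, §2 (2.17)] -/
def xiStar1Fam : ℂ := ∑ x ∈ F, (haveI : NeZero x.p := ⟨x.prime.ne_zero⟩; xiStar1Sum S χ x.ψ c' (Zs x))

/-- Family total of the abs-weight `Ξ₁`. [cite: Zhang2022LandauSiegel, §2 (2.32)] -/
def xi1AbsFam : ℝ := ∑ x ∈ F, (haveI : NeZero x.p := ⟨x.prime.ne_zero⟩; xi1AbsSum S χ x.ψ c' (Zs x))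

/-- Family total of the abs-weight `Ξ_J`. [cite: Zhang2022LandauSiegel, §2 (2.33)] -/
def xiJAbsFam : ℝ := ∑ x ∈ F, (haveI : NeZero x.p := ⟨x.prime.ne_zero⟩; xiJAbsSum S χ x.ψ c' (Zs x))

/-- Family total of the abs-weight `Ξ₂*`. [cite: Zhang2022LandauSiegel, §2 (2.19)] -/
def xiStar2AbsFam : ℝ := ∑ x ∈ F, (haveI : NeZero x.p := ⟨x.prime.ne_zero⟩; xiStar2AbsSum S χ x.ψ c' (Zs x))

/-- Family total of the abs-weight `Ξ₃*`. [cite: Zhang2022LandauSiegel, §2 (2.20)] -/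
def xiStar3AbsFam : ℝ := ∑ x ∈ F, (haveI : NeZero x.p := ⟨x.prime.ne_zero⟩; xiStar3AbsSum S χ x.ψ c' (Zs x))

variable {S χ c' F Zs}

/-- **(2.18) with abs weights for family TOTALS** (no sign hypothesis on `𝔠*`): if at every listed zero of every block
`𝔠*`, `ω` are real with `Re ω ≥ 0` and `|Z| = 1`, then `‖Σ_x Ξ₁*‖ ≤ Σ_x Ξ₂*ᵃᵇˢ + Σ_x Ξ₃*ᵃᵇˢ`.
[cite: Zhang2022LandauSiegel, §2 (2.18)] -/
theorem norm_xiStar1Fam_le_abs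
    (hci : ∀ x ∈ F, ∀ ρ ∈ Zs x, (haveI : NeZero x.p := ⟨x.prime.ne_zero⟩; (cstar S x.ψ c' ρ).im = 0))
    (hω0 : ∀ x ∈ F, ∀ ρ ∈ Zs x, 0 ≤ (omegaW S ρ).re) (hωi : ∀ x ∈ F, ∀ ρ ∈ Zs x, (omegaW S ρ).im = 0)
    (hZ : ∀ x ∈ F, ∀ ρ ∈ Zs x, (haveI : NeZero x.p := ⟨x.prime.ne_zero⟩; ‖Zpc χ x.ψ ρ‖ = 1)) :
    ‖xiStar1Fam S χ c' F Zs‖ ≤ xiStar2AbsFam S χ c' F Zs + xiStar3AbsFam S χ c' F Zs := by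
  unfold xiStar1Fam xiStar2AbsFam xiStar3AbsFam
  rw [← Finset.sum_add_distrib]
  refine (norm_sum_le _ _).trans (Finset.sum_le_sum fun x hx => ?_)
  haveI : NeZero x.p := ⟨x.prime.ne_zero⟩
  exact norm_xiStar1Sum_le_abs (hci x hx) (hω0 x hx) (hωi x hx) (hZ x hx)

/-- **Cauchy–Schwarz with abs weights for family TOTALS**: `(Σ_x Ξ₂*ᵃᵇˢ)² ≤ (Σ_x Ξ₁ᵃᵇˢ)(Σ_x Ξ_Jᵃᵇˢ)` — per-block CS
(`xiStar2AbsSum_sq_le`) aggregated by Cauchy–Schwarz over the blocks. [cite: Zhang2022LandauSiegel, §2, remark after Prop. 2.6] -/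
theorem xiStar2AbsFam_sq_le (hω : ∀ x ∈ F, ∀ ρ ∈ Zs x, 0 < (omegaW S ρ).re)
    (hZ : ∀ x ∈ F, ∀ ρ ∈ Zs x, (haveI : NeZero x.p := ⟨x.prime.ne_zero⟩; ‖Zpc χ x.ψ ρ‖ = 1)) :
    xiStar2AbsFam S χ c' F Zs ^ 2 ≤ xi1AbsFam S χ c' F Zs * xiJAbsFam S χ c' F Zs := by
  unfold xiStar2AbsFam xi1AbsFam xiJAbsFam
  refine Finset.sum_sq_le_sum_mul_sum_of_sq_le_mul F (fun x hx => ?_) (fun x hx => ?_) (fun x hx => ?_)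
  · haveI : NeZero x.p := ⟨x.prime.ne_zero⟩
    have h := (absDatum S χ x.ψ c' (Zs x) (hω x hx) (hZ x hx)).xi1_nonneg
    rwa [absDatum_xi1] at h
  · haveI : NeZero x.p := ⟨x.prime.ne_zero⟩
    have h := (absDatum S χ x.ψ c' (Zs x) (hω x hx) (hZ x hx)).xiJ_nonneg
    rwa [absDatum_xiJ] at h
  · haveI : NeZero x.p := ⟨x.prime.ne_zero⟩
    exact xiStar2AbsSum_sq_le (hω x hx) (hZ x hx)

/-- **The unconditional endgame bound on family TOTALS**: `d·aP ≤ ‖Σ Ξ₁*‖`, `Σ Ξ₁ᵃᵇˢ ≤ q·aP`, `Σ Ξ_Jᵃᵇˢ ≤ c_J·aP`,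
`Σ Ξ₃*ᵃᵇˢ ≤ ε·aP` force `d ≤ √(q·c_J) + ε` (no sign hypothesis on `𝔠*`).
[cite: Zhang2022LandauSiegel, §2 (2.18), p. 6] -/
theorem bed_ratio_le_abs_fam {aP d q cJ ε : ℝ} (haP : 0 < aP)
    (hci : ∀ x ∈ F, ∀ ρ ∈ Zs x, (haveI : NeZero x.p := ⟨x.prime.ne_zero⟩; (cstar S x.ψ c' ρ).im = 0))
    (hω : ∀ x ∈ F, ∀ ρ ∈ Zs x, 0 < (omegaW S ρ).re) (hωi : ∀ x ∈ F, ∀ ρ ∈ Zs x, (omegaW S ρ).im = 0)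
    (hZ : ∀ x ∈ F, ∀ ρ ∈ Zs x, (haveI : NeZero x.p := ⟨x.prime.ne_zero⟩; ‖Zpc χ x.ψ ρ‖ = 1))
    (h24 : d * aP ≤ ‖xiStar1Fam S χ c' F Zs‖) (h232 : xi1AbsFam S χ c' F Zs ≤ q * aP)
    (h233 : xiJAbsFam S χ c' F Zs ≤ cJ * aP) (h26 : xiStar3AbsFam S χ c' F Zs ≤ ε * aP) :
    d ≤ Real.sqrt (q * cJ) + ε := by
  have h218 := norm_xiStar1Fam_le_abs hci (fun x hx ρ hρ => (hω x hx ρ hρ).le) hωi hZ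
  have hCS := xiStar2AbsFam_sq_le (S := S) (χ := χ) (c' := c') hω hZ
  have hx1 : 0 ≤ xi1AbsFam S χ c' F Zs := Finset.sum_nonneg fun x hx => by
    haveI : NeZero x.p := ⟨x.prime.ne_zero⟩
    have h := (absDatum S χ x.ψ c' (Zs x) (hω x hx) (hZ x hx)).xi1_nonneg
    rwa [absDatum_xi1] at h
  have hxJ : 0 ≤ xiJAbsFam S χ c' F Zs := Finset.sum_nonneg fun x hx => by
    haveI : NeZero x.p := ⟨x.prime.ne_zero⟩
    have h := (absDatum S χ x.ψ c' (Zs x) (hω x hx) (hZ x hx)).xiJ_nonneg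
    rwa [absDatum_xiJ] at h
  have hx2 : 0 ≤ xiStar2AbsFam S χ c' F Zs := Finset.sum_nonneg fun x hx => by
    haveI : NeZero x.p := ⟨x.prime.ne_zero⟩
    have h := (absDatum S χ x.ψ c' (Zs x) (hω x hx) (hZ x hx)).xiStar2_nonneg
    rwa [absDatum_xiStar2] at h
  have hq : 0 ≤ q := by nlinarith
  have hcJ : 0 ≤ cJ := by nlinarith
  have h2 : xiStar2AbsFam S χ c' F Zs ≤ Real.sqrt (q * cJ) * aP := by
    calc xiStar2AbsFam S χ c' F Zs = Real.sqrt (xiStar2AbsFam S χ c' F Zs ^ 2) := (Real.sqrt_sq hx2).symm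
      _ ≤ Real.sqrt (xi1AbsFam S χ c' F Zs * xiJAbsFam S χ c' F Zs) := Real.sqrt_le_sqrt hCS
      _ ≤ Real.sqrt (q * aP * (cJ * aP)) := Real.sqrt_le_sqrt (mul_le_mul h232 h233 hxJ (by positivity))
      _ = Real.sqrt (q * cJ) * aP := by
          rw [show q * aP * (cJ * aP) = q * cJ * (aP * aP) by ring,
            Real.sqrt_mul (mul_nonneg hq hcJ), Real.sqrt_mul_self haP.le]
  have h3 : d * aP ≤ (Real.sqrt (q * cJ) + ε) * aP := by nlinarith
  exact le_of_mul_le_mul_right h3 haP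

end Family

end Literature.NumberTheory.LFunctions.Zhang2022.Repair.Bed
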